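import Literature.AlgebraicGeometry.Resolution.MacaulayficationKawasakiTheorem
import HarnessLib

/-!
# Kawasaki 2000, Corollaries 3.2 and 3.3 (Česnavičius (KI-c) and (KI-a))

Topic: `Literature/AlgebraicGeometry/Resolution`. Brick of the proof of the named facts
`KawasakiMacaulayfication` / `CesnaviciusMacaulayfication`; sequel of
`MacaulayficationKawasakiTheorem.lean` (Theorem 3.1). For a `p`-standard system of parameters
`xs` of type `d - 1` for `M` (abstractly `IsPStandard M xs`), `qᵢ = (xᵢ,…,x_d)`:

* `IsPStandard.kawasaki32` — **Corollary 3.2**: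
  `[(y)M + qᵢ^{nᵢ}⋯qⱼ^{nⱼ}M] : x_{i-1}^{n_{i-1}} = [(y)M + qᵢ^{nᵢ}⋯qⱼ^{nⱼ}M] : q_{i-1}` for
  `2 ≤ i ≤ j ≤ d` and a subsystem of parameters `y` of `M/q_{i-1}M` (Česnavičius (KI-c));
* `IsPStandard.kawasaki333` / `kawasaki331` — **(3.3.3)/(3.3.1)**: if
  `[(y_{<u})M + q_kM] : y_u = (y_{<u})M + q_kM` then `(y_{<u}, x_Λ)M : y_u = (y_{<u}, x_Λ)M` for all
  `Λ ⊆ {k,…,d}`;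
* `IsPStandard.kawasaki332` — **Corollary 3.3 (3.3.2)**: under the same hypothesis,
  `[(y_{<u},x_Λ)M + qᵢ^{nᵢ}⋯qⱼ^{nⱼ}M] : y_u = (y_{<u},x_Λ)M + qᵢ^{nᵢ}⋯qⱼ^{nⱼ}M` for `k ≤ i ≤ j`,
  `Λ ⊆ {k,…,i-1}` (Česnavičius (KI-a)).

Indexing is `0`-based as in `MacaulayficationKawasakiInduction.lean` (`tailIdeal xs i = qᵢ₊₁`,
`xs[i] = xᵢ₊₁`, `prodPow xs n i j = qᵢ₊₁^{n i}⋯qⱼ₊₁^{n j}`). Everything is proved; no named fact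
is introduced.

## References

* [Kawasaki2000] T. Kawasaki, *On Macaulayfication of Noetherian schemes*, Trans. AMS 352 (2000)
  2517–2552, Cor. 3.2, Cor. 3.3 (pp. 2530–2531).
* [Cesnavicius2021] K. Česnavičius, *Macaulayfication of Noetherian schemes*, Duke Math. J. 170
  (2021), Thm. 3.10 (KI-a), (KI-c).
-/

namespace Literature.AlgebraicGeometry.Resolution

open Ideal Submodule Module IsLocalRing
open scoped Pointwise

universe u v

section Ring

variable {R : Type u} [CommRing R]

/-- `(∏ q_t^{n_t - 1})·(∏ q_t) = ∏ q_t^{n_t}` for positive exponents. [folklore] -/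
theorem prodPow_sub_one_mul_prodPow_one (xs : List R) {n : ℕ → ℕ} {i j : ℕ}
    (hn : Kawasaki.PosOn n i j) :
    prodPow xs (fun t => n t - 1) i j * prodPow xs (fun _ => 1) i j = prodPow xs n i j := by
  rw [prodPow, prodPow, prodPow, ← Finset.prod_mul_distrib]
  refine Finset.prod_congr rfl fun t ht => ?_
  rw [← pow_add, Nat.sub_add_cancel (hn t ht)]

end Ring

variable {R : Type u} [CommRing R] [IsLocalRing R] [IsNoetherianRing R]
variable {M : Type v} [AddCommGroup M] [Module R M] [Module.Finite R M]

namespace IsPStandard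

variable {xs : List R}

/-! ## Corollary 3.2 -/

/-- **Kawasaki 2000, Corollary 3.2** (`0`-based: `p = i - 2`, the product over `[p+1, j]`):
for a `p`-standard `xs`, `p + 1 ≤ j < d`, positive exponents `n` on `[p+1, j]`, `e ≥ 1`, and a
subsystem of parameters `ys ⊆ 𝔪` of `M/q_{p+1}M` (`xs.drop p ++ ys` secant),
`[(ys)M + q^nM] : xs[p]^e = [(ys)M + q^nM] : q_{p+1}` with `q^n = ∏_{t∈[p+1,j]} q_{t+1}^{n t}`.
Proof as printed: reduce to `e = 1` by `(E)` of Theorem 3.1, bound the colon by `(C)`, and use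
that `xs.drop p` is a `d`-sequence on `M/(ys)M` (Cor. 2.10). [cite: Kawasaki2000, Cor. 3.2] -/
theorem kawasaki32 (hx : IsPStandard M xs) {p j : ℕ} (hpj : p + 1 ≤ j) (hj : j < xs.length)
    {n : ℕ → ℕ} (hn : Kawasaki.PosOn n (p + 1) j) {e : ℕ} (he : 0 < e) {ys : List R}
    (hys : IsSecantSequence M (xs.drop p ++ ys)) (hym : ∀ y ∈ ys, y ∈ maximalIdeal R) :
    colonBy (ofList ys • ⊤ ⊔ prodPow xs n (p + 1) j • ⊤ : Submodule R M) (xs[p] ^ e) =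
      colonByIdeal (ofList ys • ⊤ ⊔ prodPow xs n (p + 1) j • ⊤ : Submodule R M)
        (tailIdeal xs p) := by
  classical
  have hp : p < xs.length := by omega
  obtain ⟨-, -, hC, -, hE⟩ := hx.kawasaki31 hpj hj
  have hS := hx.mem_maximalIdeal_drop_append p hym
  have hxpm : xs[p] ∈ maximalIdeal R := hx.mem_maximalIdeal _ (List.getElem_mem hp)
  have hym' : ∀ y ∈ ys ++ [xs[p]], y ∈ maximalIdeal R := fun y hy => by
    rcases List.mem_append.mp hy with hy | hy
    · exact hym y hy
    · rw [List.mem_singleton] at hy; rw [hy]; exact hxpm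
  -- `ys, x_{p+1}` is a subsystem of parameters of `M/q_{p+2}M`
  have hsec : IsSecantSequence M (xs.drop (p + 1) ++ (ys ++ [xs[p]])) := by
    refine hys.of_perm ?_ hS
    rw [List.drop_eq_getElem_cons hp]
    exact List.perm_iff_count.mpr fun r => by
      simp only [List.count_append, List.count_cons, List.count_nil]; omega
  have hkill : KillsParameterColons (M ⧸ (tailIdeal xs (p + 1) • ⊤ : Submodule R M)) xs[p] :=
    hx.kills (xs.take p) xs[p] (xs.drop (p + 1))
      (by rw [← List.drop_eq_getElem_cons hp, List.take_append_drop])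
  -- `(E)`: the colon by `xs[p]²` is the colon by `xs[p]`, hence so is the colon by `xs[p]^e`
  have h2 := hE n hn (p + 1) le_rfl (ys ++ [xs[p]]) ys xs[p] rfl hsec hym' hkill ys.length
    (by simp) [] (List.nil_sublist _)
  have e5 : (ys ++ [xs[p]]).take ys.length = ys := by simp
  have e6 : (ys ++ [xs[p]])[ys.length]'(by simp) = xs[p] := by simp
  rw [List.append_nil, e5, e6] at h2
  have hpow : ∀ t : ℕ, colonBy (ofList ys • ⊤ ⊔ prodPow xs n (p + 1) j • ⊤ : Submodule R M)
      (xs[p] ^ (t + 1)) = colonBy (ofList ys • ⊤ ⊔ prodPow xs n (p + 1) j • ⊤ : Submodule R M)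
        xs[p] := by
    intro t
    induction t with
    | zero => rw [zero_add, pow_one]
    | succ t ih => rw [pow_succ, colonBy_mul, ih, ← colonBy_mul, h2]
  obtain ⟨t, rfl⟩ : ∃ t, e = t + 1 := ⟨e - 1, by omega⟩
  rw [hpow]
  refine le_antisymm (fun m hm => ?_) (colonByIdeal_le_colonBy _ (getElem_mem_tailIdeal le_rfl hp))
  refine mem_colonByIdeal_ofList_iff.mpr fun b hb => ?_
  rw [List.drop_eq_getElem_cons hp, List.mem_cons] at hb
  rcases hb with rfl | hb
  · exact hm
  -- `b ∈ q_{p+2}`: `(C)` gives `m = m₁ + m₂`, `m₁ ∈ (ys)M : xs[p]`, `m₂ ∈ q'M`, `q_{p+2}q' = q^n`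
  obtain ⟨m₁, hm₁, m₂, hm₂, rfl⟩ := Submodule.mem_sup.mp (hC n hn ys xs[p] hsec hym' hm)
  rw [smul_add]
  refine Submodule.add_mem _ (Submodule.mem_sup_left ?_) (Submodule.mem_sup_right ?_)
  · -- `xs.drop p` is a `d`-sequence on `M/(ys)M`
    have hK := hx.isKDSequence (X₀ := xs.take p) (D := xs.drop p) (List.take_append_drop p xs).symm
      hys hym
    have key := hK [] xs[p] (xs.drop (p + 1))
      (by rw [List.nil_append, List.drop_eq_getElem_cons hp]) b (List.mem_cons_of_mem _ hb)
    rw [Ideal.ofList_nil, Submodule.bot_smul, sup_bot_eq] at key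
    have hm₁' : m₁ ∈ colonBy (ofList ys • ⊤ : Submodule R M) (xs[p] * b) := by
      rw [mul_comm]; exact colonBy_le_colonBy_mul _ _ _ hm₁
    rw [key] at hm₁'
    exact hm₁'
  · have hbq : b ∈ tailIdeal xs (p + 1) := Ideal.subset_span hb
    have := Submodule.smul_mem_smul hbq hm₂
    rwa [← Submodule.mul_smul, ← prodPow_eq_mul_update (Finset.mem_Icc.mpr ⟨le_rfl, hpj⟩)
      (hn (p + 1) (Finset.mem_Icc.mpr ⟨le_rfl, hpj⟩))] at this

/-! ## Corollary 3.3 -/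

/-- **Kawasaki 2000, Cor. 3.3, (3.3.3)**: let `Y, y_u ⊆ 𝔪` be a subsystem of parameters of
`M/q_{k+1}M` (`xs.drop k ++ (Y ++ [y_u])` secant) with `[(Y)M + q_{k+1}M] : y_u = (Y)M + q_{k+1}M`.
Then `(Y, x_Λ)M : y_u = (Y, x_Λ)M` for every `Λ ⊆ {k+1,…,d}` (a sublist `L` of `xs.drop k`).
Proof as printed: descending induction on `|Λ|`; for the last `x_l ∉ Λ` write `a = x_lb + c` and use
(2.9.2) for `Y, x_{Λ<l}, y_u, x_l` on `M/q_{l+1}M`. [cite: Kawasaki2000, Cor. 3.3 (3.3.3)] -/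
theorem kawasaki333 (hx : IsPStandard M xs) {k : ℕ} {Y : List R} {yu : R}
    (hys : IsSecantSequence M (xs.drop k ++ (Y ++ [yu])))
    (hym : ∀ y ∈ Y ++ [yu], y ∈ maximalIdeal R)
    (H : colonBy (ofList Y • ⊤ ⊔ tailIdeal xs k • ⊤ : Submodule R M) yu =
      ofList Y • ⊤ ⊔ tailIdeal xs k • ⊤)
    {L : List R} (hL : L.Sublist (xs.drop k)) :
    colonBy (ofList (Y ++ L) • ⊤ : Submodule R M) yu = ofList (Y ++ L) • ⊤ := by
  classical
  have hS := hx.mem_maximalIdeal_drop_append k hym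
  suffices key : ∀ (g : ℕ) (L : List R), L.Sublist (xs.drop k) →
      (xs.drop k).length = L.length + g →
        colonBy (ofList (Y ++ L) • ⊤ : Submodule R M) yu = ofList (Y ++ L) • ⊤ from
    key ((xs.drop k).length - L.length) L hL (by have := hL.length_le; omega)
  intro g
  induction g with
  | zero =>
    intro L hL hlen
    obtain rfl : L = xs.drop k := hL.eq_of_length (by omega)
    rw [ofList_append_smul]
    exact H
  | succ g ih =>
    intro L hL hlen
    have hne : L ≠ xs.drop k := fun e => by rw [e] at hlen; omega
    -- the last gap `b = x_l` of `L` in `xs.drop k = A ++ b :: B`, `L = A' ++ B`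
    obtain ⟨A, A', b, B, hK, hLAB, hA'⟩ := exists_eq_append_cons_of_sublist_of_ne hL hne
    have hL₁ : (A' ++ b :: B).Sublist (xs.drop k) := by
      rw [hK]; exact hA'.append (List.Sublist.refl _)
    have ih₁ := ih (A' ++ b :: B) hL₁ (by
      rw [hLAB, List.length_append] at hlen
      rw [List.length_append, List.length_cons]; omega)
    -- `b` kills the parameter colons of `M/(B)M`
    have hxs : xs = (xs.take k ++ A ++ [b]) ++ B := by
      conv_lhs => rw [← List.take_append_drop k xs, hK]
      simp only [List.append_assoc, List.singleton_append]
    have hkill : KillsParameterColons (M ⧸ (ofList B • ⊤ : Submodule R M)) b :=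
      hx.kills (xs.take k ++ A) b B (by rw [List.append_assoc, ← hK, List.take_append_drop])
    -- (2.9.2) for `Y, A', y_u, b` on `M/(B)M`: `(Y, A', B)M : y_ub = (Y, A', B)M : b`
    have hsec : IsSecantSequence M (B ++ ((Y ++ A') ++ [yu] ++ [b])) := by
      refine hys.of_subperm ⟨A' ++ b :: B ++ (Y ++ [yu]), ?_, ?_⟩ hS
      · exact List.perm_iff_count.mpr fun r => by
          simp only [List.count_append, List.count_cons, List.count_nil]; omega
      · exact hL₁.append (List.Sublist.refl _)
    have hym' : ∀ y ∈ (Y ++ A') ++ [yu] ++ [b], y ∈ maximalIdeal R := fun y hy => by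
      simp only [List.mem_append, List.mem_singleton] at hy
      rcases hy with ((hy | hy) | rfl) | rfl
      · exact hym y (List.mem_append_left _ hy)
      · exact hx.mem_maximalIdeal y (List.mem_of_mem_drop (hL.subset (by rw [hLAB]; simp [hy])))
      · exact hym y (by simp)
      · exact hx.mem_maximalIdeal y (List.mem_of_mem_drop (by rw [hK]; simp))
    have e29 := hx.colonBy_mul_eq_colonBy hxs hsec hym' (Y := (Y ++ A') ++ [yu]) (yu := b) rfl
      (Or.inr hkill) (List.Sublist.refl B) (m := (Y ++ A').length) (by simp)
    have e5 : ((Y ++ A') ++ [yu] ++ [b]).take (Y ++ A').length = Y ++ A' := by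
      rw [List.append_assoc, List.take_left]
    have e6 : ((Y ++ A') ++ [yu] ++ [b])[(Y ++ A').length]'(by simp) = yu := by
      simp [List.getElem_append_right]
    have eL : (Y ++ A') ++ B = Y ++ L := by rw [hLAB, List.append_assoc]
    rw [e5, e6, eL] at e29
    -- `a ∈ (Y, L)M : y_u ⊆ (Y, L, b)M : y_u = (Y, L, b)M = (Y, L)M + bM`
    refine le_antisymm (fun a ha => ?_) (le_colonBy _ _)
    have ha₁ : a ∈ (ofList (Y ++ L) • ⊤ : Submodule R M) ⊔ b • ⊤ := by
      have e : (ofList (Y ++ (A' ++ b :: B)) • ⊤ : Submodule R M) = ofList (Y ++ L) • ⊤ ⊔ b • ⊤ := by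
        rw [← List.append_assoc, ofList_append_cons_smul_top, List.append_assoc, ← hLAB]
      rw [← e, ← ih₁]
      refine colonBy_mono (Submodule.smul_mono_left (ofList_mono_of_subset ?_)) _ ha
      rw [hLAB]
      intro r hr
      simp only [List.mem_append, List.mem_cons] at hr ⊢
      tauto
    rw [← Submodule.ideal_span_singleton_smul] at ha₁
    obtain ⟨c, hc, t, ht, rfl⟩ := Submodule.mem_sup.mp ha₁
    obtain ⟨b₀, -, rfl⟩ := mem_span_singleton_smul_iff.mp ht
    -- `y_ub·b₀ = y_ua - y_uc ∈ (Y, L)M`, so `b₀ ∈ (Y,L)M : y_ub = (Y,L)M : b`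
    refine Submodule.add_mem _ hc ?_
    have hb₀ : b₀ ∈ colonBy (ofList (Y ++ L) • ⊤ : Submodule R M) (yu * b) := by
      rw [mem_colonBy, mul_smul]
      have e : yu • b • b₀ = yu • (c + b • b₀) - yu • c := by rw [smul_add, add_sub_cancel_left]
      rw [e]
      exact Submodule.sub_mem _ (mem_colonBy.mp ha) (Submodule.smul_mem _ _ hc)
    rw [e29] at hb₀
    exact mem_colonBy.mp hb₀

/-- **Kawasaki 2000, Cor. 3.3, (3.3.1)**: under the hypothesis of `kawasaki333`,
`(Y)M : y_u = (Y)M`. [cite: Kawasaki2000, Cor. 3.3 (3.3.1)] -/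
theorem kawasaki331 (hx : IsPStandard M xs) {k : ℕ} {Y : List R} {yu : R}
    (hys : IsSecantSequence M (xs.drop k ++ (Y ++ [yu])))
    (hym : ∀ y ∈ Y ++ [yu], y ∈ maximalIdeal R)
    (H : colonBy (ofList Y • ⊤ ⊔ tailIdeal xs k • ⊤ : Submodule R M) yu =
      ofList Y • ⊤ ⊔ tailIdeal xs k • ⊤) :
    colonBy (ofList Y • ⊤ : Submodule R M) yu = ofList Y • ⊤ := by
  simpa using hx.kawasaki333 hys hym H (List.nil_sublist _)

/-- The subsystem of parameters `Y, x_Λ, y_u` of `M/qᵢ₊₁M` used in Cor. 3.3: if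
`xs.drop k ++ (Y ++ [y_u])` is secant, `k ≤ i` and `L` is a sublist of `seg xs k i`, then
`xs.drop i ++ ((Y ++ L) ++ [y_u])` is secant and `(Y ++ L) ++ [y_u] ⊆ 𝔪`. [folklore] -/
theorem isSecantSequence_drop_append_append (hx : IsPStandard M xs) {k i : ℕ} (hki : k ≤ i)
    {Y : List R} {yu : R} (hys : IsSecantSequence M (xs.drop k ++ (Y ++ [yu])))
    (hym : ∀ y ∈ Y ++ [yu], y ∈ maximalIdeal R) {L : List R} (hL : L.Sublist (seg xs k i)) :
    IsSecantSequence M (xs.drop i ++ ((Y ++ L) ++ [yu])) ∧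
      ∀ y ∈ (Y ++ L) ++ [yu], y ∈ maximalIdeal R := by
  classical
  refine ⟨?_, fun y hy => ?_⟩
  · refine hys.of_subperm ⟨L ++ xs.drop i ++ (Y ++ [yu]), ?_, ?_⟩
      (hx.mem_maximalIdeal_drop_append k hym)
    · exact List.perm_iff_count.mpr fun r => by simp only [List.count_append]; omega
    · rw [← seg_append_drop hki]
      exact (hL.append (List.Sublist.refl _)).append (List.Sublist.refl _)
  · simp only [List.mem_append, List.mem_singleton] at hy
    rcases hy with (hy | hy) | rfl
    · exact hym y (List.mem_append_left _ hy)
    · exact hx.mem_maximalIdeal y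
        (List.mem_of_mem_drop ((seg_sublist_drop xs k i).subset (hL.subset hy)))
    · exact hym y (by simp)

/-- **Cor. 3.3, reduction of (3.3.2) to exponents `1`** ("we may assume `nᵢ = ⋯ = nⱼ = 1` by
using `(B_ij)` of Theorem 3.1 and (3.3.1)"). [cite: Kawasaki2000, Cor. 3.3] -/
theorem kawasaki332_of_ones (hx : IsPStandard M xs) {k : ℕ} {Y : List R} {yu : R}
    (hys : IsSecantSequence M (xs.drop k ++ (Y ++ [yu])))
    (hym : ∀ y ∈ Y ++ [yu], y ∈ maximalIdeal R)
    (H : colonBy (ofList Y • ⊤ ⊔ tailIdeal xs k • ⊤ : Submodule R M) yu =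
      ofList Y • ⊤ ⊔ tailIdeal xs k • ⊤)
    {i j : ℕ} (hki : k ≤ i) (hij : i ≤ j) (hj : j < xs.length) {L : List R}
    (hL : L.Sublist (seg xs k i))
    (hones : colonBy (ofList (Y ++ L) • ⊤ ⊔ prodPow xs (fun _ => 1) i j • ⊤ : Submodule R M) yu =
      ofList (Y ++ L) • ⊤ ⊔ prodPow xs (fun _ => 1) i j • ⊤)
    {n : ℕ → ℕ} (hn : Kawasaki.PosOn n i j) :
    colonBy (ofList (Y ++ L) • ⊤ ⊔ prodPow xs n i j • ⊤ : Submodule R M) yu =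
      ofList (Y ++ L) • ⊤ ⊔ prodPow xs n i j • ⊤ := by
  obtain ⟨-, hB, -, -, -⟩ := hx.kawasaki31 hij hj
  obtain ⟨hsec, hym'⟩ := hx.isSecantSequence_drop_append_append hki hys hym hL
  have e : prodPow xs (fun t => n t - 1) i j • (prodPow xs (fun _ => 1) i j • ⊤ : Submodule R M) =
      prodPow xs n i j • ⊤ := by
    rw [← Submodule.mul_smul, prodPow_sub_one_mul_prodPow_one xs hn]
  rw [Kawasaki.b31_iterate_gen hB hj hsec hym' hn, hones,
    hx.kawasaki333 hys hym H (hL.trans (seg_sublist_drop xs k i)), Submodule.smul_sup, e]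
  refine le_antisymm (sup_le (sup_le (Submodule.smul_le_right.trans le_sup_left) le_sup_right)
    le_sup_left) (sup_le ?_ (le_sup_left.trans' le_sup_right))
  exact le_sup_right

/-- **Cor. 3.3, the inductive step of (3.3.2) for exponents `1`** (`i < j`): given `(D_ij)` and
(3.3.2) at `(i+1, j)` (for the exponents `(2,1,…,1)` with `Λ ∪ {i+1}`, and for exponents `1` with
`Λ`), `[(Y,x_Λ)M + qᵢ₊₁⋯qⱼ₊₁M] : y_u = (Y,x_Λ)M + qᵢ₊₁⋯qⱼ₊₁M`. Proof as printed (modular law and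
`(D_ij)`). [cite: Kawasaki2000, Cor. 3.3 (3.3.2)] -/
theorem kawasaki332_ones_step (hx : IsPStandard M xs) {k : ℕ} {Y : List R} {yu : R}
    (hys : IsSecantSequence M (xs.drop k ++ (Y ++ [yu])))
    (hym : ∀ y ∈ Y ++ [yu], y ∈ maximalIdeal R) {i j : ℕ} (hki : k ≤ i) (hij : i + 1 ≤ j)
    (hj : j < xs.length) (hD : Kawasaki.D31 M xs i j) {L : List R} (hL : L.Sublist (seg xs k i))
    (ih₂ : colonBy (ofList (Y ++ (L ++ [xs[i]'(by omega)])) • ⊤ ⊔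
        prodPow xs (Function.update (fun _ => 1) (i + 1) 2) (i + 1) j • ⊤ : Submodule R M) yu =
      ofList (Y ++ (L ++ [xs[i]'(by omega)])) • ⊤ ⊔
        prodPow xs (Function.update (fun _ => 1) (i + 1) 2) (i + 1) j • ⊤)
    (ih₁ : colonBy (ofList (Y ++ L) • ⊤ ⊔ prodPow xs (fun _ => 1) (i + 1) j • ⊤ : Submodule R M)
        yu = ofList (Y ++ L) • ⊤ ⊔ prodPow xs (fun _ => 1) (i + 1) j • ⊤) :
    colonBy (ofList (Y ++ L) • ⊤ ⊔ prodPow xs (fun _ => 1) i j • ⊤ : Submodule R M) yu =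
      ofList (Y ++ L) • ⊤ ⊔ prodPow xs (fun _ => 1) i j • ⊤ := by
  classical
  have hi : i < xs.length := by omega
  obtain ⟨hsec, hym'⟩ := hx.isSecantSequence_drop_append_append hki hys hym hL
  -- the ideals (as in Step 9): `Q = qᵢ₊₁Q₊`, `Q₂ = qᵢ₊₂Q₊ ⊆ Q`, `Q ⊆ (xs[i]) + Q₂`, `xs[i]Q₊ ⊆ Q`
  have hxq : span {xs[i]} ≤ tailIdeal xs i :=
    (Ideal.span_singleton_le_iff_mem _).mpr (getElem_mem_tailIdeal le_rfl hi)
  have hQ : prodPow xs (fun _ => 1) i j = tailIdeal xs i * prodPow xs (fun _ => 1) (i + 1) j := by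
    rw [prodPow_eq_mul _ (by omega : i ≤ j), pow_one]
  have hupd : prodPow xs (Function.update (Function.update (fun _ : ℕ => 1) (i + 1) 2) (i + 1)
      (Function.update (fun _ : ℕ => 1) (i + 1) 2 (i + 1) - 1)) (i + 1) j =
        prodPow xs (fun _ => 1) (i + 1) j := by
    refine prodPow_congr fun t _ => ?_
    rcases eq_or_ne t (i + 1) with rfl | ht
    · rw [Function.update_self, Function.update_self]
    · rw [Function.update_of_ne ht, Function.update_of_ne ht]
  have hQ2 : prodPow xs (Function.update (fun _ => 1) (i + 1) 2) (i + 1) j =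
      tailIdeal xs (i + 1) * prodPow xs (fun _ => 1) (i + 1) j := by
    rw [prodPow_eq_mul_update (n := Function.update (fun _ => 1) (i + 1) 2) (k := i + 1)
      (Finset.mem_Icc.mpr ⟨le_rfl, hij⟩) (by rw [Function.update_self]; exact Nat.two_pos), hupd]
  have hQ2le : prodPow xs (Function.update (fun _ => 1) (i + 1) 2) (i + 1) j ≤
      prodPow xs (fun _ => 1) i j := by
    rw [hQ2, hQ]
    exact Ideal.mul_mono_left (tailIdeal_antitone xs (Nat.le_succ i))
  have hQle : prodPow xs (fun _ => 1) i j ≤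
      span {xs[i]} ⊔ prodPow xs (Function.update (fun _ => 1) (i + 1) 2) (i + 1) j := by
    rw [hQ, tailIdeal_eq_span_sup hi, Ideal.sup_mul, ← hQ2]
    exact sup_le_sup_right Ideal.mul_le_right _
  have hle2 : span {xs[i]} • (ofList (Y ++ L) • ⊤ ⊔ prodPow xs (fun _ => 1) (i + 1) j • ⊤ :
      Submodule R M) ≤ ofList (Y ++ L) • ⊤ ⊔ prodPow xs (fun _ => 1) i j • ⊤ := by
    refine (Submodule.smul_sup _ _ _).le.trans (sup_le_sup Submodule.smul_le_right ?_)
    rw [← Submodule.mul_smul, hQ]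
    exact Submodule.smul_mono_left (Ideal.mul_mono_left hxq)
  refine le_antisymm (fun a ha => ?_) (le_colonBy _ _)
  -- `a ∈ [(Y,L,xs[i])M + Q₂M] : y_u = (Y,L,xs[i])M + Q₂M = ((Y,L)M + Q₂M) + xs[i]M`
  have hW' : (ofList (Y ++ (L ++ [xs[i]])) • ⊤ : Submodule R M) = ofList (Y ++ L) • ⊤ ⊔ xs[i] • ⊤ := by
    rw [← List.append_assoc, ofList_append_cons_smul_top, List.append_nil]
  have hle1 : (ofList (Y ++ L) • ⊤ ⊔ prodPow xs (fun _ => 1) i j • ⊤ : Submodule R M) ≤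
      (ofList (Y ++ L) • ⊤ ⊔ xs[i] • ⊤) ⊔
        prodPow xs (Function.update (fun _ => 1) (i + 1) 2) (i + 1) j • ⊤ := by
    have hsm : (prodPow xs (fun _ => 1) i j • ⊤ : Submodule R M) ≤
        xs[i] • ⊤ ⊔ prodPow xs (Function.update (fun _ => 1) (i + 1) 2) (i + 1) j • ⊤ := by
      refine (Submodule.smul_mono_left hQle).trans ?_
      rw [Submodule.sup_smul, Submodule.ideal_span_singleton_smul]
    calc _ ≤ (ofList (Y ++ L) • ⊤ : Submodule R M) ⊔ (xs[i] • ⊤ ⊔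
          prodPow xs (Function.update (fun _ => 1) (i + 1) 2) (i + 1) j • ⊤) :=
          sup_le_sup_left hsm _
      _ = _ := (sup_assoc _ _ _).symm
  have ha1 : a ∈ (ofList (Y ++ L) • ⊤ ⊔
      prodPow xs (Function.update (fun _ => 1) (i + 1) 2) (i + 1) j • ⊤ : Submodule R M) ⊔
        span {xs[i]} • ⊤ := by
    rw [Submodule.ideal_span_singleton_smul, sup_right_comm, ← hW', ← ih₂, hW']
    exact colonBy_mono hle1 _ ha
  obtain ⟨c, hc, t, ht, rfl⟩ := Submodule.mem_sup.mp ha1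
  obtain ⟨b₀, -, rfl⟩ := mem_span_singleton_smul_iff.mp ht
  refine Submodule.add_mem _ (mem_sup_of_le_right (Submodule.smul_mono_left hQ2le) hc) ?_
  -- `xs[i]b₀ ∈ [(Y,L)M + QM] : y_u ∩ xs[i]M ⊆ xs[i]{[(Y,L)M + Q₊M] : y_u} + (Y,L)M` by `(D_ij)`
  have hU : xs[i] • b₀ ∈ colonBy (ofList (Y ++ L) • ⊤ ⊔ prodPow xs (fun _ => 1) i j • ⊤ :
      Submodule R M) yu := by
    have e : xs[i] • b₀ = (c + xs[i] • b₀) - c := by rw [add_sub_cancel_left]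
    rw [e]
    exact Submodule.sub_mem _ ha
      (le_colonBy _ _ (mem_sup_of_le_right (Submodule.smul_mono_left hQ2le) hc))
  have hD' := hD hi (Y ++ L) yu hsec hym'
    (Submodule.mem_inf.mpr ⟨hU, mem_span_singleton_smul_iff.mpr ⟨b₀, Submodule.mem_top, rfl⟩⟩)
  rw [ih₁] at hD'
  obtain ⟨s, hs, w, hw, e1⟩ := Submodule.mem_sup.mp hD'
  rw [← e1]
  exact Submodule.add_mem _ (hle2 hs) (Submodule.mem_sup_left hw)

/-- **Kawasaki 2000, Corollary 3.3, (3.3.2)** (Česnavičius (KI-a)): let `xs` be `p`-standard for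
`M`, `k ≤ i ≤ j < d` (`0`-based), `n` positive on `[i, j]`, and `Y, y_u ⊆ 𝔪` a subsystem of
parameters of `M/q_{k+1}M` with `[(Y)M + q_{k+1}M] : y_u = (Y)M + q_{k+1}M`. Then for every
`Λ ⊆ {k+1,…,i}` (a sublist `L` of `seg xs k i`),
`[(Y,x_Λ)M + qᵢ₊₁^{n i}⋯qⱼ₊₁^{n j}M] : y_u = (Y,x_Λ)M + qᵢ₊₁^{n i}⋯qⱼ₊₁^{n j}M`.
Proof as printed: descending induction on `i`, reduction to exponents `1` by `(B_ij)` and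
(3.3.1), the case `i = j` by (3.3.3), the step by `(D_ij)`. [cite: Kawasaki2000, Cor. 3.3 (3.3.2)] -/
theorem kawasaki332 (hx : IsPStandard M xs) {k : ℕ} {Y : List R} {yu : R}
    (hys : IsSecantSequence M (xs.drop k ++ (Y ++ [yu])))
    (hym : ∀ y ∈ Y ++ [yu], y ∈ maximalIdeal R)
    (H : colonBy (ofList Y • ⊤ ⊔ tailIdeal xs k • ⊤ : Submodule R M) yu =
      ofList Y • ⊤ ⊔ tailIdeal xs k • ⊤)
    {i j : ℕ} (hki : k ≤ i) (hij : i ≤ j) (hj : j < xs.length) {n : ℕ → ℕ}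
    (hn : Kawasaki.PosOn n i j) {L : List R} (hL : L.Sublist (seg xs k i)) :
    colonBy (ofList (Y ++ L) • ⊤ ⊔ prodPow xs n i j • ⊤ : Submodule R M) yu =
      ofList (Y ++ L) • ⊤ ⊔ prodPow xs n i j • ⊤ := by
  classical
  suffices key : ∀ (g i : ℕ), i + g = j → k ≤ i → ∀ (n : ℕ → ℕ), Kawasaki.PosOn n i j →
      ∀ (L : List R), L.Sublist (seg xs k i) →
        colonBy (ofList (Y ++ L) • ⊤ ⊔ prodPow xs n i j • ⊤ : Submodule R M) yu =
          ofList (Y ++ L) • ⊤ ⊔ prodPow xs n i j • ⊤ from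
    key (j - i) i (by omega) hki n hn L hL
  intro g
  induction g with
  | zero =>
    intro i hi hki n hn L hL
    obtain rfl : i = j := by omega
    refine hx.kawasaki332_of_ones hys hym H hki le_rfl hj hL ?_ hn
    -- `i = j`, exponents `1`: (3.3.3) with `Λ ∪ {i+1,…,d}`
    have e : (ofList (Y ++ L) • ⊤ ⊔ prodPow xs (fun _ => 1) i i • ⊤ : Submodule R M) =
        ofList (Y ++ (L ++ xs.drop i)) • ⊤ := by
      rw [prodPow_self, pow_one, ofList_append_smul, ofList_append_smul, ofList_append_smul,
        sup_assoc]
    rw [e]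
    refine hx.kawasaki333 hys hym H ?_
    rw [← seg_append_drop hki]
    exact hL.append (List.Sublist.refl _)
  | succ g ih =>
    intro i hi hki n hn L hL
    have hij : i + 1 ≤ j := by omega
    have hi' : i < xs.length := by omega
    obtain ⟨-, -, -, hD, -⟩ := hx.kawasaki31 (by omega : i ≤ j) hj
    refine hx.kawasaki332_of_ones hys hym H hki (by omega) hj hL ?_ hn
    have hn₂ : Kawasaki.PosOn (Function.update (fun _ => 1) (i + 1) 2) (i + 1) j := fun t _ => by
      rcases eq_or_ne t (i + 1) with rfl | ht
      · rw [Function.update_self]; exact Nat.two_pos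
      · rw [Function.update_of_ne ht]; exact Nat.one_pos
    have hL1 : L.Sublist (seg xs k (i + 1)) := by
      rw [seg_succ hki hi']; exact hL.trans (List.sublist_append_left _ _)
    have hL2 : (L ++ [xs[i]]).Sublist (seg xs k (i + 1)) := by
      rw [seg_succ hki hi']; exact hL.append (List.Sublist.refl _)
    exact hx.kawasaki332_ones_step hys hym hki hij hj hD hL
      (ih (i + 1) (by omega) (by omega) _ hn₂ _ hL2)
      (ih (i + 1) (by omega) (by omega) _ (Kawasaki.posOn_one _ _) _ hL1)

end IsPStandard

end Literature.AlgebraicGeometry.Resolution
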